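import Mathlib.Geometry.Manifold.Diffeomorph
import Mathlib.Geometry.Manifold.IsManifold.InteriorBoundary
import Mathlib.MeasureTheory.Constructions.BorelSpace.Basic
import HarnessLib

/-!
# Recharting a manifold without boundary over the model vector space: the identity becomes a
# diffeomorphism onto a manifold modelled on `𝓘(ℝ, E')`

Let `X` be a `C^∞` manifold modelled on a real model with corners `I : ModelWithCorners ℝ E H`
which is a manifold without boundary in the sense of Mathlib's `BoundarylessManifold I X` (every
point is an interior point) — this does NOT require the model `I` itself to be boundaryless
(`I.Boundaryless`). Many analytic results of this tree (Green's identity, chart formulas for the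
Laplace–Beltrami operator and the Riemannian measure, elliptic regularity read in charts) are
stated for boundaryless MODELS, indeed for manifolds charted on `EuclideanSpace ℝ (Fin m)`
(model `𝓡 m`). This file provides the bridge: for a continuous linear equivalence
`e : E ≃L[ℝ] E'` (e.g. onto `EuclideanSpace ℝ (Fin (finrank ℝ E))`) the type synonym
`ExtRechart I e X` carries the charted-space structure over `E'` whose charts are the extended
charts of `X` followed by `e` — their targets are open because interior points are
chart-independent on `C¹` manifolds (Mathlib's `isInteriorPoint_iff_of_mem_atlas`) — and

* `ExtRechart.instIsManifold` — it is a `C^∞` manifold for the model `𝓘(ℝ, E')` (the transition maps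
  are `e ∘ (extended coordinate changes of X) ∘ e⁻¹`, `ModelWithCorners.contDiffOn_extendCoordChange`);
* `ExtRechart.toOrig` — **the identity `ExtRechart I e X → X` is a `C^∞` diffeomorphism** (in the charts at
  a point it reads `e⁻¹`, resp. `e`);
* the topology, σ-algebra and separation/countability instances are those of `X`.

(The tree's `Literature.Geometry.Manifold.Rechart f M` (`ModelChange.lean`) transports an atlas along a
homeomorphism `f : H ≃ₜ E'` of the MODEL SPACES, which exists only when `H` itself is a vector
space up to homeomorphism — the boundaryless-model case; here the model `I` may have corners and
only the manifold is without boundary, whence the extended charts.)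
(Lee, *Introduction to Smooth Manifolds*, 2nd ed., Ch. 1: smooth structures are unchanged by
composing charts with a diffeomorphism of the model; interior charts of a manifold with boundary
form a smooth atlas of its interior, Thm. 1.46 / Problem 1-9.) Everything is proved; the file
introduces the definitions `ExtRechart`, `ExtRechart.chart`, `ExtRechart.toOrig` and no statement of
`Prop` type.

## References

* J. M. Lee, *Introduction to Smooth Manifolds*, 2nd ed., GTM 218 (2013), Ch. 1, Prop. 1.17,
  Thm. 1.46. [`Lee2013`]
-/

noncomputable section

open Set Function Filter Topology
open scoped Manifold ContDiff

namespace Literature.Geometry.Manifold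

variable {E : Type*} [NormedAddCommGroup E] [NormedSpace ℝ E]
  {E' : Type*} [NormedAddCommGroup E'] [NormedSpace ℝ E']
  {H : Type*} [TopologicalSpace H]

/-- **The recharted manifold** `ExtRechart I e X`: the same points and topology as `X`, to be charted
over the vector space `E'` by the extended charts of `X` followed by `e : E ≃L[ℝ] E'`.
(Lee 2013, Ch. 1: an atlas composed with a diffeomorphism of the model.) [cite: Lee2013, Ch. 1, Prop. 1.17] -/
@[nolint unusedArguments]
def ExtRechart (_I : ModelWithCorners ℝ E H) (_e : E ≃L[ℝ] E') (X : Type*) : Type _ := X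

namespace ExtRechart

variable (I : ModelWithCorners ℝ E H) (e : E ≃L[ℝ] E') (X : Type*)

/-- The identification of `ExtRechart I e X` with `X` (the identity map). [folklore] -/
def equivOrig : ExtRechart I e X ≃ X := Equiv.refl _

/-- The topology of `ExtRechart I e X` is that of `X`. [folklore] -/
instance [t : TopologicalSpace X] : TopologicalSpace (ExtRechart I e X) := t
/-- Hausdorffness is inherited from `X`. [folklore] -/
instance [TopologicalSpace X] [T2Space X] : T2Space (ExtRechart I e X) := ‹T2Space X›
/-- `T₃` is inherited from `X`. [folklore] -/
instance [TopologicalSpace X] [T3Space X] : T3Space (ExtRechart I e X) := ‹T3Space X›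
/-- Second countability is inherited from `X`. [folklore] -/
instance [TopologicalSpace X] [SecondCountableTopology X] : SecondCountableTopology (ExtRechart I e X) :=
  ‹SecondCountableTopology X›
/-- Connectedness is inherited from `X`. [folklore] -/
instance [TopologicalSpace X] [ConnectedSpace X] : ConnectedSpace (ExtRechart I e X) := ‹ConnectedSpace X›
/-- σ-compactness is inherited from `X`. [folklore] -/
instance [TopologicalSpace X] [SigmaCompactSpace X] : SigmaCompactSpace (ExtRechart I e X) :=
  ‹SigmaCompactSpace X›
/-- Local compactness is inherited from `X`. [folklore] -/
instance [TopologicalSpace X] [LocallyCompactSpace X] : LocallyCompactSpace (ExtRechart I e X) :=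
  ‹LocallyCompactSpace X›
/-- The σ-algebra of `ExtRechart I e X` is that of `X`. [folklore] -/
instance [m : MeasurableSpace X] : MeasurableSpace (ExtRechart I e X) := m
/-- The Borel property is inherited from `X`. [folklore] -/
instance [TopologicalSpace X] [MeasurableSpace X] [BorelSpace X] : BorelSpace (ExtRechart I e X) :=
  ‹BorelSpace X›

variable {I e X}
variable [TopologicalSpace X] [ChartedSpace H X]

/-- **Extended chart targets of a manifold without boundary are open** (in `E`): every point of
the chart domain is an interior point, and interior points are chart-independent on `C¹` manifolds
(`isInteriorPoint_iff_of_mem_atlas`), so the target consists of interior points of itself.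
[folklore] -/
theorem isOpen_extChartAt_target [IsManifold I 1 X] [BoundarylessManifold I X] (x : X) :
    IsOpen (extChartAt I x).target := by
  rw [← subset_interior_iff_isOpen]
  intro z hz
  set y := (extChartAt I x).symm z with hy
  have hys : y ∈ (chartAt H x).source := by
    rw [← extChartAt_source I]; exact (extChartAt I x).map_target hz
  have hint : I.IsInteriorPoint y := BoundarylessManifold.isInteriorPoint' y
  have h1 := (I.isInteriorPoint_iff_of_mem_atlas (n := 1) one_ne_zero (chart_mem_atlas H x) hys).1 hint
  have hzy : (chartAt H x).extend I y = z := (extChartAt I x).right_inv hz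
  rwa [hzy] at h1

variable (I e) in
/-- The chart of `ExtRechart I e X` at `x`: the extended chart of `X` at `x` followed by `e`, as an
open partial homeomorphism `X ⇀ E'` (its target `e '' (extChartAt I x).target` is open for a
manifold without boundary). [folklore] -/
def chart [IsManifold I 1 X] [BoundarylessManifold I X] (x : X) : OpenPartialHomeomorph X E' where
  toFun y := e (extChartAt I x y)
  invFun z := (extChartAt I x).symm (e.symm z)
  source := (chartAt H x).source
  target := e.symm ⁻¹' (extChartAt I x).target
  map_source' y hy := by
    show e.symm (e (extChartAt I x y)) ∈ (extChartAt I x).target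
    rw [e.symm_apply_apply]
    exact (extChartAt I x).map_source (by rwa [extChartAt_source])
  map_target' z hz := by
    show (extChartAt I x).symm (e.symm z) ∈ (chartAt H x).source
    rw [← extChartAt_source I]
    exact (extChartAt I x).map_target hz
  left_inv' y hy := by
    show (extChartAt I x).symm (e.symm (e (extChartAt I x y))) = y
    rw [e.symm_apply_apply]
    exact (extChartAt I x).left_inv (by rwa [extChartAt_source])
  right_inv' z hz := by
    show e (extChartAt I x ((extChartAt I x).symm (e.symm z))) = z
    rw [(extChartAt I x).right_inv hz, e.apply_symm_apply]
  open_source := (chartAt H x).open_source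
  open_target := (isOpen_extChartAt_target x).preimage e.symm.continuous
  continuousOn_toFun := by
    show ContinuousOn (fun y ↦ e (extChartAt I x y)) (chartAt H x).source
    rw [← extChartAt_source I]
    exact e.continuous.comp_continuousOn (continuousOn_extChartAt x)
  continuousOn_invFun := by
    show ContinuousOn (fun z ↦ (extChartAt I x).symm (e.symm z)) (e.symm ⁻¹' (extChartAt I x).target)
    exact (continuousOn_extChartAt_symm x).comp e.symm.continuous.continuousOn fun z hz ↦ hz

/-- The chart is `e ∘ extChartAt I x`. [folklore] -/
@[simp]
theorem chart_apply [IsManifold I 1 X] [BoundarylessManifold I X] (x y : X) :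
    chart (X := X) I e x y = e (extChartAt I x y) := rfl

/-- The inverse chart is `(extChartAt I x).symm ∘ e⁻¹`. [folklore] -/
@[simp]
theorem chart_symm_apply [IsManifold I 1 X] [BoundarylessManifold I X] (x : X) (z : E') :
    (chart (X := X) I e x).symm z = (extChartAt I x).symm (e.symm z) := rfl

/-- The chart domain is the chart domain of `X` at `x`. [folklore] -/
theorem chart_source [IsManifold I 1 X] [BoundarylessManifold I X] (x : X) :
    (chart (X := X) I e x).source = (chartAt H x).source := rfl

/-- The chart target is `e '' (extChartAt I x).target`. [folklore] -/
theorem chart_target [IsManifold I 1 X] [BoundarylessManifold I X] (x : X) :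
    (chart (X := X) I e x).target = e.symm ⁻¹' (extChartAt I x).target := rfl

/-- The charted-space structure of `ExtRechart I e X` over `E'`. [folklore] -/
instance instChartedSpace [IsManifold I 1 X] [BoundarylessManifold I X] :
    ChartedSpace E' (ExtRechart I e X) where
  atlas := range fun x : X ↦ chart (X := X) I e x
  chartAt x := chart (X := X) I e (@id X x)
  mem_chart_source x := by
    show (@id X x) ∈ (chartAt H (@id X x)).source
    exact mem_chart_source H (@id X x)
  chart_mem_atlas x := mem_range_self (@id X x)

/-- The preferred chart of `ExtRechart I e X` at `x` is `chart I e x`. [folklore] -/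
theorem chartAt_eq [IsManifold I 1 X] [BoundarylessManifold I X] (x : ExtRechart I e X) :
    chartAt E' x = chart (X := X) I e (@id X x) := rfl

/-- **`ExtRechart I e X` is a `C^∞` manifold over `𝓘(ℝ, E')`**: the transition map between the charts
at `x` and `y` is `e ∘ (extended coordinate change of X) ∘ e⁻¹`, smooth by
`ModelWithCorners.contDiffOn_extendCoordChange`. [cite: Lee2013, Ch. 1, Prop. 1.17] -/
instance instIsManifold [IsManifold I ∞ X] [BoundarylessManifold I X] :
    IsManifold 𝓘(ℝ, E') ∞ (ExtRechart I e X) := by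
  haveI : IsManifold I 1 X := IsManifold.of_le (n := ∞) (by norm_num)
  refine isManifold_of_contDiffOn 𝓘(ℝ, E') ∞ (ExtRechart I e X) ?_
  rintro c c' ⟨x, rfl⟩ ⟨y, rfl⟩
  simp only [modelWithCornersSelf_coe, modelWithCornersSelf_coe_symm, CompTriple.comp_eq, range_id,
    inter_univ, preimage_id_eq, id_eq]
  -- the transition map is `e ∘ extendCoordChange ∘ e.symm` on `e '' (coord change source)`
  have hcc := I.contDiffOn_extendCoordChange (n := ∞) (IsManifold.chart_mem_maximalAtlas (I := I) x)
    (IsManifold.chart_mem_maximalAtlas (I := I) y)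
  have hcomp : ContDiffOn ℝ ∞ (e ∘ I.extendCoordChange (chartAt H x) (chartAt H y) ∘ e.symm)
      (e.symm ⁻¹' (I.extendCoordChange (chartAt H x) (chartAt H y)).source) :=
    e.contDiff.comp_contDiffOn (hcc.comp e.symm.contDiff.contDiffOn fun z hz ↦ hz)
  refine hcomp.congr_mono (fun z hz ↦ ?_) ?_
  · -- pointwise the two maps agree
    simp only [OpenPartialHomeomorph.trans_apply, Function.comp_apply,
      ModelWithCorners.extendCoordChange, PartialEquiv.trans_apply]
    rfl
  · -- the sources agree
    intro z hz
    simp only [OpenPartialHomeomorph.trans_source, OpenPartialHomeomorph.symm_source, mem_inter_iff,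
      mem_preimage] at hz
    show e.symm z ∈ (I.extendCoordChange (chartAt H x) (chartAt H y)).source
    rw [ModelWithCorners.extendCoordChange, PartialEquiv.trans_source, PartialEquiv.symm_source]
    refine ⟨hz.1, ?_⟩
    simp only [mem_preimage, OpenPartialHomeomorph.extend_source]
    have h2 := hz.2
    rw [chart_source] at h2
    exact h2

/-- The extended chart of `ExtRechart I e X` at `x` is the chart (the model being `𝓘(ℝ, E')`).
[folklore] -/
theorem extChartAt_eq [IsManifold I 1 X] [BoundarylessManifold I X] (x : ExtRechart I e X) :
    extChartAt 𝓘(ℝ, E') x = (chart (X := X) I e (@id X x)).toPartialEquiv := by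
  refine PartialEquiv.ext (fun y ↦ ?_) (fun z ↦ ?_) ?_
  · rw [extChartAt_coe, chartAt_eq]; rfl
  · rw [extChartAt_coe_symm, chartAt_eq]; rfl
  · rw [extChartAt_source, chartAt_eq]

/-- **The identity `ExtRechart I e X → X` is a `C^∞` diffeomorphism** (in the charts at `x` it reads
`e⁻¹` near `e (φ x)`, and its inverse reads `e` on the chart target, a neighbourhood of `φ x`
within `range I`). [cite: Lee2013, Ch. 1, Prop. 1.17] -/
def toOrig [IsManifold I ∞ X] [BoundarylessManifold I X] :
    Diffeomorph 𝓘(ℝ, E') I (ExtRechart I e X) X ∞ where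
  toEquiv := Equiv.refl _
  contMDiff_toFun := by
    haveI : IsManifold I 1 X := IsManifold.of_le (n := ∞) (by norm_num)
    intro x
    rw [contMDiffAt_iff]
    refine ⟨continuousAt_id, ?_⟩
    simp only [modelWithCornersSelf_coe, range_id, extChartAt_eq]
    -- `extChartAt I x ∘ id ∘ (e ∘ extChartAt I x)⁻¹ = e⁻¹` near `e (φ x)`
    have hx : (@id X x) ∈ (extChartAt I (@id X x)).source := mem_extChartAt_source _
    have hev : (extChartAt I (@id X x)) ∘ (id : ExtRechart I e X → X) ∘
        (chart (X := X) I e (@id X x)).toPartialEquiv.symm =ᶠ[𝓝 ((chart (X := X) I e (@id X x)) x)]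
        fun z ↦ e.symm z := by
      have hT : (extChartAt I (@id X x)).target ∈ 𝓝 (extChartAt I (@id X x) x) :=
        (isOpen_extChartAt_target _).mem_nhds ((extChartAt I _).map_source hx)
      have hT' : e.symm ⁻¹' (extChartAt I (@id X x)).target ∈ 𝓝 ((chart (X := X) I e (@id X x)) x) := by
        refine e.symm.continuous.continuousAt.preimage_mem_nhds ?_
        simpa [chart_apply] using hT
      filter_upwards [hT'] with z hz
      simp only [Function.comp_apply, id_eq]
      show extChartAt I (@id X x) ((chart (X := X) I e (@id X x)).symm z) = e.symm z
      rw [chart_symm_apply, (extChartAt I _).right_inv hz]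
    refine (e.symm.contDiff.contDiffAt.contDiffWithinAt).congr_of_eventuallyEq_of_mem ?_ (mem_univ _)
    exact hev.filter_mono nhdsWithin_le_nhds |>.symm.symm
  contMDiff_invFun := by
    haveI : IsManifold I 1 X := IsManifold.of_le (n := ∞) (by norm_num)
    intro x
    rw [contMDiffAt_iff]
    refine ⟨continuousAt_id, ?_⟩
    simp only [extChartAt_eq]
    -- `(e ∘ φ) ∘ id ∘ φ⁻¹ = e` on `φ.target`, a neighbourhood of `φ x` within `range I`
    have hev : ((chart (X := X) I e x).toPartialEquiv ∘ (id : X → ExtRechart I e X) ∘ (extChartAt I x).symm)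
        =ᶠ[𝓝[range I] (extChartAt I x x)] fun z ↦ e z := by
      filter_upwards [extChartAt_target_mem_nhdsWithin x] with z hz
      simp only [Function.comp_apply, id_eq]
      show chart (X := X) I e x ((extChartAt I x).symm z) = e z
      rw [chart_apply, (extChartAt I x).right_inv hz]
    refine (e.contDiff.contDiffAt.contDiffWithinAt).congr_of_eventuallyEq_of_mem hev.symm.symm ?_
    exact mem_range_self _

/-- `toOrig` is the identity on points. [folklore] -/
@[simp]
theorem toOrig_apply [IsManifold I ∞ X] [BoundarylessManifold I X] (x : ExtRechart I e X) :
    toOrig (I := I) (e := e) x = (@id X x) := rfl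

/-- `toOrig.symm` is the identity on points. [folklore] -/
@[simp]
theorem toOrig_symm_apply [IsManifold I ∞ X] [BoundarylessManifold I X] (x : X) :
    (toOrig (I := I) (e := e) (X := X)).symm x = (show ExtRechart I e X from x) := rfl

end ExtRechart

end Literature.Geometry.Manifold

end
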